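import Summits.AtomisticToContinuum.BoseEinsteinCondensation.Theorems.BECThomsonPrincipleGDTransferSeededSpectralDefs
import Summits.AtomisticToContinuum.BoseEinsteinCondensation.Theorems.BECThomsonPrincipleGDTransferSeededSectorBlockAlgebra
import Summits.AtomisticToContinuum.BoseEinsteinCondensation.Theorems.BECThomsonPrincipleGDTransferSeededCountLaw

/-!
# Route `BECThomsonPrinciple`, crux `GDTransfer` (stmt-AtomisticToContinuum-9482), line `seeded-continuity`:
# registered sub-goal `smoothBlockAlgebra` (spectral seed programme) — the algebra of the two smooth blocks

Supports (does not close) stmt-AtomisticToContinuum-9482.  Proves the registered sub-goal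
`smoothBlockAlgebra : SmoothBlockAlgebra` of `BECThomsonPrincipleGDTransferSeededSpectralDefs.lean`: for band
parameters `θ, β > 0`, `θ + β < 1`, and every periodic trial state `Ψ` at `(N, L) = (m+1, L)`, `L > 0`, the two
smooth blocks `f = χ_lo(n̂₀/N)Ψ = Σ_S χ_lo(|S|/N) Q_S Ψ` and `g = χ_hi(n̂₀/N)Ψ` (`smoothBlock`, `Q_S = Negative.modeProj`)

* are admissible variation directions (`IsDirection`: `C¹`, `Lℤ³`-periodic in every particle, Bose-symmetric) —
  termwise from `Lnss.contDiff_modeProj`, `Lnss.modeProj_periodic`, and the relabelling covariance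
  `Lnss.modeProj_comp_perm` followed by the re-indexing `S ↦ τS` of the sum, which preserves `|S|` and hence the
  coefficient `χ(|S|/N)` (verbatim the argument of `SectorBlock.sectorBlock_comp_perm` / `Lnss.rootInv_comp_perm`);
* have masses `‖f‖² = Σ_S χ_lo(|S|/N)² w_S`, `‖g‖² = Σ_S χ_hi(|S|/N)² w_S` (`w_S = compMass S Ψ = ‖Q_SΨ‖²`) —
  Pythagoras for the orthogonal family `Q_S Ψ` (`Lnss.integral_norm_sq_sum_modeProj`) moved to `ℝ≥0∞` by
  `Lnss.lintegral_nnnorm_sq_eq`; so `‖f‖² + ‖g‖² = Σ_S (χ_lo² + χ_hi²) w_S = Σ_S w_S = 1` (`cutLo_sq_add_cutHi_sq`,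
  `sum_compMass_trialState` = CountLaw (1a));
* have inner product `⟨f, g⟩ = Σ_S χ_lo(|S|/N) χ_hi(|S|/N) w_S` — expand, kill the cross terms `S ≠ T` by
  `Lnss.integral_conj_modeProj_mul_modeProj`, and `∫ conj(Q_SΨ) Q_SΨ = ‖Q_SΨ‖²` (`Lnss.integral_conj_mul_self`).

All [folklore] (LSSY2005 App. A: the `P_i` are commuting self-adjoint idempotents on `L²(cell^N)`;
CyconFroeseKirschSimon1987 §3.1 for the IMS partition of unity — background only).
-/

noncomputable section

open MeasureTheory Filter
open scoped ENNReal NNReal ComplexConjugate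

namespace Summit.AtomisticToContinuum.BoseEinsteinCondensation.Cruxes.GDTransfer.Seeded

open Literature.MathematicalPhysics.QuantumManyBody.BoseGas
open Summit.AtomisticToContinuum.BoseEinsteinCondensation.Theses.BECThomsonPrinciple
open Summit.AtomisticToContinuum.BoseEinsteinCondensation.Theorems.GaussianDominationCan.Negative (modeProj)
open Summit.AtomisticToContinuum.BoseEinsteinCondensation.Cruxes.GDTransfer.DysonDressedWitness (IsDirection mass)
open Summit.AtomisticToContinuum.BoseEinsteinCondensation.Cruxes.GDTransfer.DysonDressedWitness.ChordVariation
  (continuous_modeProj)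
open Summit.AtomisticToContinuum.BoseEinsteinCondensation.Cruxes.GDTransfer.DysonDressedWitness.Lnss
  (contDiff_modeProj modeProj_periodic modeProj_comp_perm integral_conj_modeProj_mul_modeProj
    integral_norm_sq_sum_modeProj lintegral_nnnorm_sq_eq integral_conj_mul_self)

namespace SmoothBlock

variable {m : ℕ} {L : ℝ}

/-! ## Pointwise form and regularity of a smooth block -/

/-- A smooth block evaluated at a configuration: `(χ(n̂₀/N)ψ)(X) = Σ_S χ(|S|/N) (Q_S ψ)(X)`. [folklore] -/
theorem smoothBlock_apply (χ : ℝ → ℝ) (ψ : Config (m + 1) → ℂ) (X : Config (m + 1)) :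
    smoothBlock m L χ ψ X =
      ∑ S : Finset (Fin (m + 1)), (χ ((S.card : ℝ) / ((m : ℝ) + 1)) : ℂ) * modeProj (m + 1) L S ψ X :=
  rfl

/-- **Smooth blocks of `C¹` functions are `C¹`** (`Q_S` preserves `C¹`, finite sum). [folklore] -/
theorem contDiff_smoothBlock (χ : ℝ → ℝ) {ψ : Config (m + 1) → ℂ} (hψ : ContDiff ℝ 1 ψ) :
    ContDiff ℝ 1 (smoothBlock m L χ ψ) := by
  unfold smoothBlock
  exact ContDiff.sum fun S _ => contDiff_const.mul (contDiff_modeProj S hψ)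

/-- Smooth blocks of continuous functions are continuous. [folklore] -/
theorem continuous_smoothBlock (χ : ℝ → ℝ) {ψ : Config (m + 1) → ℂ} (hψ : Continuous ψ) :
    Continuous (smoothBlock m L χ ψ) := by
  unfold smoothBlock
  exact continuous_finsetSum _ fun S _ => continuous_const.mul (continuous_modeProj S hψ)

/-- **Smooth blocks of periodic functions are periodic** (`Q_S` preserves periodicity). [folklore] -/
theorem smoothBlock_periodic (χ : ℝ → ℝ) {ψ : Config (m + 1) → ℂ}
    (hψ : ∀ (X : Config (m + 1)) (j : Fin (m + 1)) (k : Fin 3),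
      ψ (X + Pi.single j (EuclideanSpace.single k L)) = ψ X)
    (X : Config (m + 1)) (j : Fin (m + 1)) (k : Fin 3) :
    smoothBlock m L χ ψ (X + Pi.single j (EuclideanSpace.single k L)) = smoothBlock m L χ ψ X := by
  unfold smoothBlock
  exact Finset.sum_congr rfl fun S _ => by rw [modeProj_periodic S hψ X j k]

/-- **Smooth blocks of continuous Bose-symmetric functions are Bose-symmetric**: relabelling covariance
`(Q_S ψ)(X ∘ τ) = (Q_{τS} ψ)(X)` and the re-indexing `S ↦ τS`, which preserves `|S|`. [folklore] -/
theorem smoothBlock_comp_perm (χ : ℝ → ℝ) {ψ : Config (m + 1) → ℂ} (hψ : Continuous ψ)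
    (hsymm : ∀ (σ : Equiv.Perm (Fin (m + 1))) (X : Config (m + 1)), ψ (X ∘ σ) = ψ X)
    (τ : Equiv.Perm (Fin (m + 1))) (X : Config (m + 1)) :
    smoothBlock m L χ ψ (X ∘ τ) = smoothBlock m L χ ψ X := by
  -- adapted from `Lnss.rootInv_comp_perm` / `SectorBlock.sectorBlock_comp_perm`
  have hψτ : (fun Y => ψ (Y ∘ τ)) = ψ := funext fun Y => hsymm τ Y
  have hQ : ∀ S : Finset (Fin (m + 1)),
      modeProj (m + 1) L S ψ (X ∘ τ) = modeProj (m + 1) L (S.map τ.toEmbedding) ψ X := by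
    intro S
    have h := congrFun (modeProj_comp_perm (L := L) τ S hψ) X
    rw [hψτ] at h
    exact h
  unfold smoothBlock
  simp only [hQ]
  rw [← Equiv.sum_comp (Equiv.finsetCongr τ)
    (fun S : Finset (Fin (m + 1)) => (χ ((S.card : ℝ) / ((m : ℝ) + 1)) : ℂ) * modeProj (m + 1) L S ψ X)]
  refine Finset.sum_congr rfl fun S _ => ?_
  simp only [Equiv.finsetCongr_apply, Finset.card_map]

/-- **Smooth blocks of directions are directions.** [folklore] -/
theorem isDirection_smoothBlock (χ : ℝ → ℝ) {ψ : Config (m + 1) → ℂ} (hψ : IsDirection m L ψ) :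
    IsDirection m L (smoothBlock m L χ ψ) :=
  ⟨contDiff_smoothBlock χ hψ.contDiff, smoothBlock_periodic χ hψ.periodic,
    fun σ X => smoothBlock_comp_perm χ hψ.contDiff.continuous hψ.symm σ X⟩

/-! ## Mass and inner product in terms of the law `w_S = ‖Q_S ψ‖²` -/

/-- The component mass as a real integral: `w_S(ψ) = ofReal ∫ |Q_S ψ|²` for continuous `ψ`. [folklore] -/
theorem compMass_eq_ofReal {ψ : Config (m + 1) → ℂ} (hψ : Continuous ψ) (S : Finset (Fin (m + 1))) :
    compMass m L S ψ = ENNReal.ofReal (∫ X in cellN (m + 1) L, ‖modeProj (m + 1) L S ψ X‖ ^ 2) :=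
  lintegral_nnnorm_sq_eq _ (continuous_modeProj S hψ)

/-- `(w_S(ψ)).toReal = ∫ |Q_S ψ|²` for continuous `ψ`. [folklore] -/
theorem toReal_compMass {ψ : Config (m + 1) → ℂ} (hψ : Continuous ψ) (S : Finset (Fin (m + 1))) :
    (compMass m L S ψ).toReal = ∫ X in cellN (m + 1) L, ‖modeProj (m + 1) L S ψ X‖ ^ 2 := by
  rw [compMass_eq_ofReal hψ S, ENNReal.toReal_ofReal (integral_nonneg fun X => sq_nonneg _)]

/-- **The mass of a smooth block** (Pythagoras for the orthogonal family `Q_S ψ`, in `ℝ≥0∞`):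
`‖χ(n̂₀/N)ψ‖² = Σ_S χ(|S|/N)² w_S(ψ)`. [folklore] -/
theorem mass_smoothBlock (hL : 0 < L) (χ : ℝ → ℝ) {ψ : Config (m + 1) → ℂ} (hψ : Continuous ψ) :
    mass L (smoothBlock m L χ ψ) =
      ∑ S : Finset (Fin (m + 1)),
        ENNReal.ofReal (χ ((S.card : ℝ) / ((m : ℝ) + 1)) ^ 2) * compMass m L S ψ := by
  unfold mass
  simp only [compMass_eq_ofReal hψ]
  rw [lintegral_nnnorm_sq_eq _ (continuous_smoothBlock χ hψ)]
  have hP := integral_norm_sq_sum_modeProj hL (Finset.univ : Finset (Finset (Fin (m + 1))))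
    (fun S => (χ ((S.card : ℝ) / ((m : ℝ) + 1)) : ℂ)) hψ
  simp only [smoothBlock_apply]
  rw [hP, ENNReal.ofReal_sum_of_nonneg fun S _ =>
    mul_nonneg (sq_nonneg _) (integral_nonneg fun X => sq_nonneg _)]
  refine Finset.sum_congr rfl fun S _ => ?_
  rw [ENNReal.ofReal_mul (sq_nonneg _), Complex.norm_real, Real.norm_eq_abs, sq_abs]

/-- The component masses of a continuous function are finite. [folklore] -/
theorem compMass_ne_top {ψ : Config (m + 1) → ℂ} (hψ : Continuous ψ) (S : Finset (Fin (m + 1))) :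
    compMass m L S ψ ≠ ⊤ := by
  rw [compMass_eq_ofReal hψ S]
  exact ENNReal.ofReal_ne_top

/-- **The mass of a smooth block, real form**: `‖χ(n̂₀/N)ψ‖².toReal = Σ_S χ(|S|/N)² w_S(ψ).toReal`. [folklore] -/
theorem toReal_mass_smoothBlock (hL : 0 < L) (χ : ℝ → ℝ) {ψ : Config (m + 1) → ℂ} (hψ : Continuous ψ) :
    (mass L (smoothBlock m L χ ψ)).toReal =
      ∑ S : Finset (Fin (m + 1)), χ ((S.card : ℝ) / ((m : ℝ) + 1)) ^ 2 * (compMass m L S ψ).toReal := by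
  rw [mass_smoothBlock hL χ hψ, ENNReal.toReal_sum fun S _ =>
    ENNReal.mul_ne_top ENNReal.ofReal_ne_top (compMass_ne_top hψ S)]
  refine Finset.sum_congr rfl fun S _ => ?_
  rw [ENNReal.toReal_mul, ENNReal.toReal_ofReal (sq_nonneg _)]

/-- **The masses of the two smooth blocks of a periodic trial state add up to `1`**:
`Σ_S (χ_lo² + χ_hi²)(|S|/N) w_S = Σ_S w_S = 1`. [folklore] -/
theorem mass_cutLo_add_mass_cutHi (hL : 0 < L) (θ β : ℝ) (Ψ : PeriodicTrialState (m + 1) L) :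
    mass L (smoothBlock m L (cutLo θ β) Ψ.ψ) + mass L (smoothBlock m L (cutHi θ β) Ψ.ψ) = 1 := by
  have hψ : Continuous Ψ.ψ := Ψ.contDiff.continuous
  rw [mass_smoothBlock hL _ hψ, mass_smoothBlock hL _ hψ, ← Finset.sum_add_distrib,
    ← sum_compMass_trialState hL Ψ]
  refine Finset.sum_congr rfl fun S _ => ?_
  rw [← add_mul, ← ENNReal.ofReal_add (sq_nonneg _) (sq_nonneg _), cutLo_sq_add_cutHi_sq,
    ENNReal.ofReal_one, one_mul]

/-- **The inner product of two smooth blocks of the same function**: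
`⟨χ₁(n̂₀/N)ψ, χ₂(n̂₀/N)ψ⟩ = Σ_S χ₁(|S|/N) χ₂(|S|/N) w_S(ψ)` (orthogonality of the `Q_S ψ`). [folklore] -/
theorem integral_conj_smoothBlock_mul_smoothBlock (hL : 0 < L) (χ₁ χ₂ : ℝ → ℝ)
    {ψ : Config (m + 1) → ℂ} (hψ : Continuous ψ) :
    (∫ X in cellN (m + 1) L, conj (smoothBlock m L χ₁ ψ X) * smoothBlock m L χ₂ ψ X) =
      ((∑ S : Finset (Fin (m + 1)), χ₁ ((S.card : ℝ) / ((m : ℝ) + 1)) *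
          χ₂ ((S.card : ℝ) / ((m : ℝ) + 1)) * (compMass m L S ψ).toReal : ℝ) : ℂ) := by
  -- adapted from `Lnss.integral_norm_sq_sum_modeProj`
  have hQ : ∀ S, Continuous (modeProj (m + 1) L S ψ) := fun S => continuous_modeProj S hψ
  set c₁ : Finset (Fin (m + 1)) → ℂ := fun S => (χ₁ ((S.card : ℝ) / ((m : ℝ) + 1)) : ℂ) with hc₁
  set c₂ : Finset (Fin (m + 1)) → ℂ := fun S => (χ₂ ((S.card : ℝ) / ((m : ℝ) + 1)) : ℂ) with hc₂
  have hint : ∀ S T, Integrable (fun X => conj (c₁ S) * c₂ T *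
      (conj (modeProj (m + 1) L S ψ X) * modeProj (m + 1) L T ψ X))
      ((volume : Measure (Config (m + 1))).restrict (cellN (m + 1) L)) := fun S T =>
    integrableOn_cellN (continuous_const.mul
      ((Complex.continuous_conj.comp (hQ S)).mul (hQ T))) L
  calc (∫ X in cellN (m + 1) L, conj (smoothBlock m L χ₁ ψ X) * smoothBlock m L χ₂ ψ X)
      = ∫ X in cellN (m + 1) L, ∑ S : Finset (Fin (m + 1)), ∑ T : Finset (Fin (m + 1)),
          conj (c₁ S) * c₂ T * (conj (modeProj (m + 1) L S ψ X) * modeProj (m + 1) L T ψ X) := by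
        refine integral_congr_ae (Filter.Eventually.of_forall fun X => ?_)
        dsimp only
        rw [smoothBlock_apply, smoothBlock_apply, map_sum, Finset.sum_mul_sum]
        refine Finset.sum_congr rfl fun S _ => Finset.sum_congr rfl fun T _ => ?_
        rw [map_mul]
        ring
    _ = ∑ S : Finset (Fin (m + 1)), ∑ T : Finset (Fin (m + 1)), ∫ X in cellN (m + 1) L,
          conj (c₁ S) * c₂ T * (conj (modeProj (m + 1) L S ψ X) * modeProj (m + 1) L T ψ X) := by
        rw [integral_finsetSum _ fun S _ => integrable_finsetSum _ fun T _ => hint S T]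
        exact Finset.sum_congr rfl fun S _ => integral_finsetSum _ fun T _ => hint S T
    _ = ∑ S : Finset (Fin (m + 1)), ((χ₁ ((S.card : ℝ) / ((m : ℝ) + 1)) *
          χ₂ ((S.card : ℝ) / ((m : ℝ) + 1)) * (compMass m L S ψ).toReal : ℝ) : ℂ) := by
        refine Finset.sum_congr rfl fun S hS => ?_
        rw [Finset.sum_eq_single_of_mem S hS fun T _ hTS => ?_]
        · rw [integral_const_mul, integral_conj_mul_self, toReal_compMass hψ S, hc₁, hc₂]
          dsimp only
          rw [Complex.conj_ofReal]
          push_cast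
          ring
        · rw [integral_const_mul, integral_conj_modeProj_mul_modeProj hL (Ne.symm hTS) hψ, mul_zero]
    _ = ((∑ S : Finset (Fin (m + 1)), χ₁ ((S.card : ℝ) / ((m : ℝ) + 1)) *
          χ₂ ((S.card : ℝ) / ((m : ℝ) + 1)) * (compMass m L S ψ).toReal : ℝ) : ℂ) := by
        push_cast
        rfl

end SmoothBlock

/-- **Registered sub-goal `smoothBlockAlgebra` of the line `seeded-continuity` (spectral seed programme).**
ALGEBRA OF THE TWO SMOOTH BLOCKS `f = χ_lo(n̂₀/N)Ψ`, `g = χ_hi(n̂₀/N)Ψ` of a periodic trial state: both are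
directions; their masses and their inner product are the `χ_lo²`-, `χ_hi²`- and `χ_loχ_hi`-weighted sums of the
component masses `w_S = ‖Q_SΨ‖²`; the masses add up to `1` (`χ_lo² + χ_hi² = 1`, `Σ_S w_S = 1`). [folklore] -/
theorem smoothBlockAlgebra : SmoothBlockAlgebra := by
  intro m L hL θ β _ _ _ Ψ
  have hψ : Continuous Ψ.ψ := Ψ.contDiff.continuous
  have hdir : IsDirection m L Ψ.ψ := ⟨Ψ.contDiff, Ψ.periodic, Ψ.symm⟩
  exact ⟨SmoothBlock.isDirection_smoothBlock _ hdir, SmoothBlock.isDirection_smoothBlock _ hdir,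
    SmoothBlock.mass_cutLo_add_mass_cutHi hL θ β Ψ,
    SmoothBlock.toReal_mass_smoothBlock hL _ hψ, SmoothBlock.toReal_mass_smoothBlock hL _ hψ,
    SmoothBlock.integral_conj_smoothBlock_mul_smoothBlock hL _ _ hψ⟩

end Summit.AtomisticToContinuum.BoseEinsteinCondensation.Cruxes.GDTransfer.Seeded

end
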